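import Mathlib
import Summits.ResolutionOfSingularities.ResolutionOfSingularities.Theorems.WeightedInvariantDatumToEmbeddedStrictTransformCharts
import HarnessLib

/-!
# Graded bookkeeping for the ambient chart: transport, homogeneous subalgebras, localisation
# at a homogeneous element, saturation of homogeneous ideals

Topic: `Summits/ResolutionOfSingularities/ResolutionOfSingularities/Theorems`. Helper file of the
stub `stub_qs_atlas_ambient` of the line `Sketch` of the crux `Theses.WeightedInvariant.DatumToEmbedded`
(statement `stmt-ResolutionOfSingularities-0572`) of the summit
`Summit.ResolutionOfSingularities.ResolutionOfSingularities`.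

Folklore about a commutative ring `S = ⨁ₖ Sₖ` graded by an additive commutative monoid (Mathlib
`GradedRing`, pieces as `ℤ`-submodules; Bourbaki, *Algèbre commutative* II §2 no. 9, III §1):

* `comapPiece` / `nonempty_gradedRing_comapPiece` — **transport of a grading along a ring
  isomorphism `e : R ≃+* S` and a re-indexing `g : κ' ≃+ κ`**: `R_{k'} := e⁻¹(S_{g k'})`; a
  homogeneous ideal pulls back to a homogeneous ideal (`isHomogeneous_comap`);
* `subalgebraPiece` / `nonempty_gradedRing_subalgebraPiece` — **a subalgebra containing the
  homogeneous components of its elements is graded** by the traces of the pieces;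
* `awayPiece` / `nonempty_gradedRing_awayPiece` — **the localisation `S[1/h]` at a HOMOGENEOUS
  element `h ∈ S_δ` is graded** by `S[1/h]ₖ := {y / hⁿ | y ∈ S_{k + n δ}}` (the case `δ = 0` is
  `…QuotientSingularitiesGradedLocalization.awayPiece`; here `δ` is arbitrary, so the degrees are
  shifted: geometrically, the torus-stable basic open `D(h)` of a torus embedding);
* `isHomogeneous_map_algebraMap`, `isHomogeneous_iSup_colon` — the extension of a homogeneous
  ideal to `S[1/h]` is homogeneous, and **the saturation `⋃ₙ (J : tⁿ)` of a homogeneous ideal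
  by a homogeneous element is homogeneous**.

Only Mathlib is used (and `mem_iSup_colon_span_singleton_pow_iff` of
`…DatumToEmbeddedStrictTransformCharts`); the gradings are returned as `Nonempty (GradedRing _)`.
-/

-- the summit namespace repeats `ResolutionOfSingularities` by design (mandated namespace)
set_option linter.dupNamespace false

namespace Summit.ResolutionOfSingularities.ResolutionOfSingularities.Theorems.DatumToEmbedded.AtlasAmbient

open DirectSum

/-! ## Transport of a grading along a ring isomorphism and a re-indexing -/

section Transport

variable {κ κ' R S : Type*} [AddCommMonoid κ] [AddCommMonoid κ'] [CommRing R] [CommRing S]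
  (e : R ≃+* S) (𝒮 : κ → Submodule ℤ S) (g : κ' ≃+ κ)

/-- **The transported grading**: `R_{k'} := e⁻¹(S_{g k'})`. [folklore] -/
def comapPiece (k : κ') : Submodule ℤ R :=
  (𝒮 (g k)).comap (e.toAddEquiv.toIntLinearEquiv : R →ₗ[ℤ] S)

variable {e 𝒮 g} in
/-- Membership in a transported piece. [folklore] -/
theorem mem_comapPiece_iff {k : κ'} {x : R} : x ∈ comapPiece e 𝒮 g k ↔ e x ∈ 𝒮 (g k) :=
  Iff.rfl

variable {e 𝒮 g} in
/-- `e⁻¹` of a homogeneous element is homogeneous. [folklore] -/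
theorem symm_mem_comapPiece {k : κ'} {y : S} (hy : y ∈ 𝒮 (g k)) : e.symm y ∈ comapPiece e 𝒮 g k := by
  rw [mem_comapPiece_iff, RingEquiv.apply_symm_apply]
  exact hy

variable [DecidableEq κ] [GradedRing 𝒮]

/-- The transported pieces form a graded monoid. [folklore] -/
theorem gradedMonoid_comapPiece : SetLike.GradedMonoid (comapPiece e 𝒮 g) where
  one_mem := by
    rw [mem_comapPiece_iff, map_one, map_zero]
    exact SetLike.one_mem_graded 𝒮
  mul_mem k k' x y hx hy := by
    rw [mem_comapPiece_iff, map_mul, map_add]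
    exact SetLike.mul_mem_graded hx hy

/-- The transported pieces are independent. [folklore] -/
theorem iSupIndep_comapPiece : iSupIndep (comapPiece e 𝒮 g) := by
  let f : Submodule ℤ R ≃o Submodule ℤ S :=
    Submodule.orderIsoMapComap (e.toAddEquiv.toIntLinearEquiv : R ≃ₗ[ℤ] S)
  have hf : (f ∘ comapPiece e 𝒮 g) = 𝒮 ∘ g := by
    funext k
    change Submodule.map _ (Submodule.comap _ (𝒮 (g k))) = 𝒮 (g k)
    exact Submodule.map_comap_eq_of_surjective
      (e.toAddEquiv.toIntLinearEquiv : R ≃ₗ[ℤ] S).surjective _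
  rw [← iSupIndep_map_orderIso_iff f, hf]
  exact (Decomposition.isInternal 𝒮).submodule_iSupIndep.comp g.injective

/-- The transported pieces span. [folklore] -/
theorem iSup_comapPiece_eq_top : ⨆ k, comapPiece e 𝒮 g k = ⊤ := by
  classical
  rw [eq_top_iff]
  rintro x -
  rw [← e.symm_apply_apply x, ← sum_support_decompose 𝒮 (e x), map_sum]
  refine Submodule.sum_mem _ fun i _ => Submodule.mem_iSup_of_mem (g.symm i)
    (symm_mem_comapPiece ?_)
  rw [AddEquiv.apply_symm_apply]
  exact SetLike.coe_mem _

/-- **Transport of a grading**: along a ring isomorphism `e : R ≃+* S` and a re-indexing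
`g : κ' ≃+ κ`, the pieces `e⁻¹(S_{g k'})` grade `R`. [folklore] -/
theorem nonempty_gradedRing_comapPiece [DecidableEq κ'] : Nonempty (GradedRing (comapPiece e 𝒮 g)) :=
  have hint : DirectSum.IsInternal (comapPiece e 𝒮 g) :=
    (DirectSum.isInternal_submodule_iff_iSupIndep_and_iSup_eq_top _).2
      ⟨iSupIndep_comapPiece e 𝒮 g, iSup_comapPiece_eq_top e 𝒮 g⟩
  ⟨{ (gradedMonoid_comapPiece e 𝒮 g) with toDecomposition := hint.chooseDecomposition }⟩

omit [DecidableEq κ] [GradedRing 𝒮] in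
/-- `e⁻¹` of a homogeneous element is homogeneous (existential form). [folklore] -/
theorem isHomogeneousElem_symm {y : S} (hy : SetLike.IsHomogeneousElem 𝒮 y) :
    SetLike.IsHomogeneousElem (comapPiece e 𝒮 g) (e.symm y) := by
  obtain ⟨i, hi⟩ := hy
  refine ⟨g.symm i, symm_mem_comapPiece ?_⟩
  rw [AddEquiv.apply_symm_apply]
  exact hi

/-- **A homogeneous ideal pulls back to a homogeneous ideal** along `e`, for the transported
grading (and ANY graded-ring structure on the transported pieces). [folklore] -/
theorem isHomogeneous_comap [DecidableEq κ'] [GradedRing (comapPiece e 𝒮 g)] {I : Ideal S}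
    (hI : I.IsHomogeneous 𝒮) : (I.comap e).IsHomogeneous (comapPiece e 𝒮 g) := by
  obtain ⟨T, rfl⟩ := (Ideal.IsHomogeneous.iff_exists 𝒮 _).mp hI
  rw [← Ideal.map_symm, Ideal.map_span]
  refine Ideal.homogeneous_span _ _ ?_
  rintro _ ⟨_, ⟨t, _, rfl⟩, rfl⟩
  exact isHomogeneousElem_symm e 𝒮 g t.2

end Transport

/-! ## A subalgebra stable under taking homogeneous components is graded -/

section Subalgebra

variable {κ A₀ R : Type*} [AddCommMonoid κ] [DecidableEq κ] [CommRing A₀] [CommRing R] [Algebra A₀ R]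
  (ℛ : κ → Submodule ℤ R) [GradedRing ℛ] (S : Subalgebra A₀ R)

/-- **The traces `S ∩ R_k` of the pieces on a subalgebra `S`.** [folklore] -/
def subalgebraPiece (k : κ) : Submodule ℤ S :=
  (ℛ k).comap (S.val.toRingHom.toAddMonoidHom.toIntLinearMap : S →ₗ[ℤ] R)

variable {ℛ S} in
omit [AddCommMonoid κ] [DecidableEq κ] [GradedRing ℛ] in
/-- Membership in a trace piece. [folklore] -/
theorem mem_subalgebraPiece_iff {k : κ} {x : S} : x ∈ subalgebraPiece ℛ S k ↔ (x : R) ∈ ℛ k :=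
  Iff.rfl

/-- The trace pieces form a graded monoid. [folklore] -/
theorem gradedMonoid_subalgebraPiece : SetLike.GradedMonoid (subalgebraPiece ℛ S) where
  one_mem := by
    rw [mem_subalgebraPiece_iff, OneMemClass.coe_one]
    exact SetLike.one_mem_graded ℛ
  mul_mem k k' x y hx hy := by
    rw [mem_subalgebraPiece_iff, MulMemClass.coe_mul]
    exact SetLike.mul_mem_graded hx hy

/-- The trace pieces are independent. [folklore] -/
theorem iSupIndep_subalgebraPiece : iSupIndep (subalgebraPiece ℛ S) := by
  rw [iSupIndep_iff_finsetSum_eq_zero_imp_eq_zero]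
  intro s v hv hsum k hk
  have hsum' : ∑ i ∈ s, (v i : R) = 0 := by
    rw [← AddSubmonoidClass.coe_finsetSum, hsum, ZeroMemClass.coe_zero]
  have h := (iSupIndep_iff_finsetSum_eq_zero_imp_eq_zero ℛ).1
    (Decomposition.isInternal ℛ).submodule_iSupIndep s (fun i => (v i : R)) hv hsum' k hk
  exact_mod_cast h

variable (hS : ∀ x ∈ S, ∀ k, (decompose ℛ x k : R) ∈ S)
include hS

/-- If `S` contains the homogeneous components of its elements, the trace pieces span. [folklore] -/
theorem iSup_subalgebraPiece_eq_top : ⨆ k, subalgebraPiece ℛ S k = ⊤ := by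
  classical
  rw [eq_top_iff]
  rintro x -
  have hx : x = ∑ k ∈ (decompose ℛ (x : R)).support,
      (⟨(decompose ℛ (x : R) k : R), hS x x.2 k⟩ : S) := by
    apply Subtype.ext
    rw [AddSubmonoidClass.coe_finsetSum]
    exact (sum_support_decompose ℛ (x : R)).symm
  rw [hx]
  exact Submodule.sum_mem _ fun k _ => Submodule.mem_iSup_of_mem k
    (mem_subalgebraPiece_iff.2 (SetLike.coe_mem _))

/-- **A subalgebra containing the homogeneous components of its elements is graded** by the
traces of the pieces. [folklore] -/
theorem nonempty_gradedRing_subalgebraPiece : Nonempty (GradedRing (subalgebraPiece ℛ S)) :=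
  have hint : DirectSum.IsInternal (subalgebraPiece ℛ S) :=
    (DirectSum.isInternal_submodule_iff_iSupIndep_and_iSup_eq_top _).2
      ⟨iSupIndep_subalgebraPiece ℛ S, iSup_subalgebraPiece_eq_top ℛ S hS⟩
  ⟨{ (gradedMonoid_subalgebraPiece ℛ S) with toDecomposition := hint.chooseDecomposition }⟩

end Subalgebra

/-! ## The localisation at a homogeneous element of arbitrary degree -/

section Away

variable {κ S : Type*} [AddCommGroup κ] [DecidableEq κ] [CommRing S] (𝒮 : κ → Submodule ℤ S)
  [GradedRing 𝒮] {δ : κ} {h : S} (hh : h ∈ 𝒮 δ) (L : Type*) [CommRing L] [Algebra S L]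

/-- **The graded pieces of `S[1/h]` for `h` homogeneous of degree `δ`**:
`S[1/h]_k = {x | hⁿ x` comes from `S_{k + n δ}` for some `n}` (the `y / hⁿ`, `y ∈ S_{k + nδ}`).
[folklore] -/
def awayPiece (k : κ) : Submodule ℤ L where
  carrier := {x | ∃ n : ℕ, ∃ y ∈ 𝒮 (k + n • δ), algebraMap S L h ^ n * x = algebraMap S L y}
  zero_mem' := ⟨0, 0, zero_mem _, by simp⟩
  add_mem' := by
    rintro x x' ⟨n, y, hy, hx⟩ ⟨m, y', hy', hx'⟩
    refine ⟨n + m, h ^ m * y + h ^ n * y', add_mem ?_ ?_, ?_⟩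
    · have e : k + (n + m) • δ = m • δ + (k + n • δ) := by rw [add_nsmul]; abel
      rw [e]
      exact SetLike.mul_mem_graded (SetLike.pow_mem_graded m hh) hy
    · have e : k + (n + m) • δ = n • δ + (k + m • δ) := by rw [add_nsmul]; abel
      rw [e]
      exact SetLike.mul_mem_graded (SetLike.pow_mem_graded n hh) hy'
    · rw [map_add, map_mul, map_mul, map_pow, map_pow, ← hx, ← hx']
      ring
  smul_mem' := by
    rintro c x ⟨n, y, hy, hx⟩
    refine ⟨n, c • y, Submodule.smul_mem _ c hy, ?_⟩
    rw [zsmul_eq_mul, zsmul_eq_mul, map_mul, map_intCast, ← hx]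
    ring

variable {𝒮 L} in
/-- Membership in a graded piece of the localisation. [folklore] -/
theorem mem_awayPiece_iff {k : κ} {x : L} : x ∈ awayPiece 𝒮 hh L k ↔
    ∃ n : ℕ, ∃ y ∈ 𝒮 (k + n • δ), algebraMap S L h ^ n * x = algebraMap S L y :=
  Iff.rfl

variable {𝒮 L} in
/-- The image of a homogeneous element is homogeneous of the same degree. [folklore] -/
theorem algebraMap_mem_awayPiece {k : κ} {y : S} (hy : y ∈ 𝒮 k) :
    algebraMap S L y ∈ awayPiece 𝒮 hh L k :=
  ⟨0, y, by simpa using hy, by simp⟩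

/-- The pieces of the localisation form a graded monoid. [folklore] -/
theorem gradedMonoid_awayPiece : SetLike.GradedMonoid (awayPiece 𝒮 hh L) where
  one_mem := ⟨0, 1, by simpa using SetLike.one_mem_graded 𝒮, by simp⟩
  mul_mem := by
    rintro k k' x x' ⟨n, y, hy, hx⟩ ⟨m, y', hy', hx'⟩
    refine ⟨n + m, y * y', ?_, ?_⟩
    · have e : k + k' + (n + m) • δ = (k + n • δ) + (k' + m • δ) := by rw [add_nsmul]; abel
      rw [e]
      exact SetLike.mul_mem_graded hy hy'
    · rw [map_mul, ← hx, ← hx']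
      ring

variable [IsLocalization.Away h L]

/-- The pieces of the localisation span: `y / hⁿ = ∑ₖ yₖ / hⁿ`. [folklore] -/
theorem iSup_awayPiece_eq_top : ⨆ k, awayPiece 𝒮 hh L k = ⊤ := by
  classical
  rw [eq_top_iff]
  rintro x -
  obtain ⟨⟨a, s⟩, hx⟩ := IsLocalization.surj (Submonoid.powers h) x
  obtain ⟨n, hn⟩ := (Submonoid.mem_powers_iff _ _).1 s.2
  obtain ⟨u, hu⟩ : ∃ u : L, algebraMap S L h * u = 1 :=
    ⟨IsLocalization.Away.invSelf h, IsLocalization.Away.mul_invSelf h⟩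
  have hx' : x = algebraMap S L a * u ^ n := by
    have h1 : algebraMap S L h ^ n * u ^ n = 1 := by rw [← mul_pow, hu, one_pow]
    calc x = x * (algebraMap S L h ^ n * u ^ n) := by rw [h1, mul_one]
      _ = algebraMap S L a * u ^ n := by rw [← mul_assoc, ← map_pow, hn, hx]
  rw [hx', ← sum_support_decompose 𝒮 a, map_sum, Finset.sum_mul]
  refine Submodule.sum_mem _ fun i _ => Submodule.mem_iSup_of_mem (i - n • δ)
    ⟨n, decompose 𝒮 a i, by rw [sub_add_cancel]; exact SetLike.coe_mem _, ?_⟩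
  rw [mul_left_comm, ← mul_pow, hu, one_pow, mul_one]

/-- The pieces of the localisation are independent: a relation `∑ₖ xₖ = 0`, `xₖ ∈ S[1/h]ₖ`,
becomes after clearing denominators a relation `hᵐ ∑ₖ yₖ = 0` in `S` between homogeneous elements
of the distinct degrees `k + (m + N) δ`. [folklore] -/
theorem iSupIndep_awayPiece : iSupIndep (awayPiece 𝒮 hh L) := by
  classical
  rw [iSupIndep_iff_finsetSum_eq_zero_imp_eq_zero]
  intro s v hv hsum
  choose! n a ha hva using fun i (hi : i ∈ s) => (mem_awayPiece_iff hh).1 (hv i hi)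
  -- common denominator `h ^ N`
  set N := ∑ i ∈ s, n i with hN
  have hle : ∀ i ∈ s, n i ≤ N := fun i hi =>
    Finset.single_le_sum (f := n) (fun _ _ => Nat.zero_le _) hi
  have hva' : ∀ i ∈ s, algebraMap S L h ^ N * v i = algebraMap S L (h ^ (N - n i) * a i) :=
    fun i hi => by
      rw [map_mul, map_pow, ← hva i hi, ← mul_assoc, ← pow_add, Nat.sub_add_cancel (hle i hi)]
  have hrel : algebraMap S L (∑ i ∈ s, h ^ (N - n i) * a i) = 0 := by
    rw [map_sum, ← Finset.sum_congr rfl hva', ← Finset.mul_sum, hsum, mul_zero]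
  obtain ⟨⟨c, hc⟩, hc0⟩ := (IsLocalization.map_eq_zero_iff (Submonoid.powers h) L _).1 hrel
  obtain ⟨m, rfl⟩ := (Submonoid.mem_powers_iff _ _).1 hc
  rw [Finset.mul_sum] at hc0
  -- the terms `h ^ m (h ^ (N - n i) a i)` are homogeneous of the distinct degrees `i + (m + N) δ`
  have hmem : ∀ i ∈ s, h ^ m * (h ^ (N - n i) * a i) ∈ 𝒮 (i + (m + N) • δ) := by
    intro i hi
    have e : i + (m + N) • δ = m • δ + ((N - n i) • δ + (i + n i • δ)) := by
      have hN' : (m + N) • δ = m • δ + ((N - n i) • δ + n i • δ) := by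
        rw [← add_nsmul, ← add_nsmul, Nat.sub_add_cancel (hle i hi)]
      rw [hN']
      abel
    rw [e]
    exact SetLike.mul_mem_graded (SetLike.pow_mem_graded m hh)
      (SetLike.mul_mem_graded (SetLike.pow_mem_graded _ hh) (ha i hi))
  have hindep := (iSupIndep_iff_finsetSum_eq_zero_imp_eq_zero fun i => 𝒮 (i + (m + N) • δ)).1
    ((Decomposition.isInternal 𝒮).submodule_iSupIndep.comp (add_left_injective _)) s
    (fun i => h ^ m * (h ^ (N - n i) * a i)) hmem hc0
  -- back in `L`: `h ^ (m + N) * v i = 0`, and `h` is a unit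
  intro i hi
  have h1 : algebraMap S L h ^ (m + N) * v i = 0 := by
    rw [pow_add, mul_assoc, hva' i hi, ← map_pow, ← map_mul, hindep i hi, map_zero]
  exact (IsUnit.mul_right_eq_zero ((IsLocalization.Away.algebraMap_isUnit h).pow _)).1 h1

/-- **The localisation of a graded ring at a homogeneous element is graded** by the pieces
`S[1/h]_k = h^{-ℕ} S_{k + ℕδ}`. [folklore] -/
theorem nonempty_gradedRing_awayPiece : Nonempty (GradedRing (awayPiece 𝒮 hh L)) :=
  have hint : DirectSum.IsInternal (awayPiece 𝒮 hh L) :=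
    (DirectSum.isInternal_submodule_iff_iSupIndep_and_iSup_eq_top _).2
      ⟨iSupIndep_awayPiece 𝒮 hh L, iSup_awayPiece_eq_top 𝒮 hh L⟩
  ⟨{ (gradedMonoid_awayPiece 𝒮 hh L) with toDecomposition := hint.chooseDecomposition }⟩

omit [IsLocalization.Away h L] in
/-- **The extension of a homogeneous ideal to `S[1/h]` is homogeneous** (for any graded-ring
structure on the pieces `awayPiece`). [folklore] -/
theorem isHomogeneous_map_algebraMap [GradedRing (awayPiece 𝒮 hh L)] {I : Ideal S}
    (hI : I.IsHomogeneous 𝒮) : (I.map (algebraMap S L)).IsHomogeneous (awayPiece 𝒮 hh L) := by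
  obtain ⟨T, rfl⟩ := (Ideal.IsHomogeneous.iff_exists 𝒮 _).mp hI
  rw [Ideal.map_span]
  refine Ideal.homogeneous_span _ _ ?_
  rintro _ ⟨_, ⟨t, _, rfl⟩, rfl⟩
  obtain ⟨i, hi⟩ := t.2
  exact ⟨i, algebraMap_mem_awayPiece hh hi⟩

end Away

/-! ## Homogeneity only depends on membership; images of homogeneous ideals -/

section Membership

variable {κ A B σ σ' τ : Type*} [DecidableEq κ] [AddMonoid κ] [CommRing A] [CommRing B]
  [SetLike σ A] [AddSubmonoidClass σ A] [SetLike σ' A] [AddSubmonoidClass σ' A]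
  [SetLike τ B] [AddSubmonoidClass τ B]
  (𝒜 : κ → σ) (𝒜' : κ → σ') (ℬ : κ → τ) [GradedRing 𝒜] [GradedRing 𝒜'] [GradedRing ℬ]

/-- **Homogeneity of an ideal only depends on the underlying subsets of the grading**: if
`x ∈ 𝒜' i ↔ x ∈ 𝒜 i` then an ideal homogeneous for `𝒜` is homogeneous for `𝒜'` (it is spanned
by homogeneous elements). [folklore] -/
theorem isHomogeneous_of_mem_iff (h : ∀ i x, x ∈ 𝒜' i ↔ x ∈ 𝒜 i) {I : Ideal A}
    (hI : I.IsHomogeneous 𝒜) : I.IsHomogeneous 𝒜' := by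
  obtain ⟨T, rfl⟩ := (Ideal.IsHomogeneous.iff_exists 𝒜 _).mp hI
  refine Ideal.homogeneous_span _ _ ?_
  rintro _ ⟨t, _, rfl⟩
  obtain ⟨i, hi⟩ := t.2
  exact ⟨i, (h i _).2 hi⟩

/-- **The extension of a homogeneous ideal along a ring map sending homogeneous elements to
homogeneous elements is homogeneous.** [folklore] -/
theorem isHomogeneous_map_of_forall (f : A →+* B)
    (hf : ∀ (i : κ) (x : A), x ∈ 𝒜 i → SetLike.IsHomogeneousElem ℬ (f x)) {I : Ideal A}
    (hI : I.IsHomogeneous 𝒜) : (I.map f).IsHomogeneous ℬ := by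
  obtain ⟨T, rfl⟩ := (Ideal.IsHomogeneous.iff_exists 𝒜 _).mp hI
  rw [Ideal.map_span]
  refine Ideal.homogeneous_span _ _ ?_
  rintro _ ⟨_, ⟨t, _, rfl⟩, rfl⟩
  obtain ⟨i, hi⟩ := t.2
  exact hf i _ hi

end Membership

/-! ## The saturation of a homogeneous ideal by a homogeneous element -/

section Saturation

variable {κ A σ : Type*} [AddCommGroup κ] [DecidableEq κ] [CommRing A] [SetLike σ A]
  [AddSubmonoidClass σ A] (𝒜 : κ → σ) [GradedRing 𝒜]

/-- **The saturation `⋃ₙ (J : tⁿ)` of a homogeneous ideal `J` by a homogeneous element `t` is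
homogeneous**: if `tⁿ x ∈ J` then `tⁿ x_k`, the component of `tⁿ x` of degree `n deg t + k`, lies
in `J`. [folklore] -/
theorem isHomogeneous_iSup_colon {t : A} {i : κ} (ht : t ∈ 𝒜 i) {J : Ideal A}
    (hJ : J.IsHomogeneous 𝒜) :
    (⨆ n : ℕ, J.colon ((Ideal.span {t} ^ n : Ideal A) : Set A)).IsHomogeneous 𝒜 := by
  intro k x hx
  rw [StrictTransform.mem_iSup_colon_span_singleton_pow_iff] at hx ⊢
  obtain ⟨n, hn⟩ := hx
  refine ⟨n, ?_⟩
  have h := hJ (n • i + k) hn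
  rwa [coe_decompose_mul_add_of_left_mem 𝒜 (SetLike.pow_mem_graded n ht)] at h

end Saturation

/-! ## Registered form -/

/-- **Registered sub-goal `stub_qs_atlasAmbientGraded`** of the crux (helper of the stub
`stub_qs_atlas_ambient`): the localisation of a graded ring at a homogeneous element of any
degree is graded. [folklore] -/
theorem stub_qs_atlasAmbientGraded :
    ∀ {κ S : Type} [AddCommGroup κ] [DecidableEq κ] [CommRing S] (𝒮 : κ → Submodule ℤ S)
      [GradedRing 𝒮] {δ : κ} {h : S} (hh : h ∈ 𝒮 δ) (L : Type) [CommRing L] [Algebra S L]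
      [IsLocalization.Away h L],
      Nonempty (GradedRing
        (Summit.ResolutionOfSingularities.ResolutionOfSingularities.Theorems.DatumToEmbedded.AtlasAmbient.awayPiece
          𝒮 hh L)) :=
  fun 𝒮 _ _ _ hh L _ _ _ => nonempty_gradedRing_awayPiece 𝒮 hh L

end Summit.ResolutionOfSingularities.ResolutionOfSingularities.Theorems.DatumToEmbedded.AtlasAmbient
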